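import Summits.CriticalPhenomena.CardyFormulaZ2.Theses.CardySelfDualSegment
import Summits.CriticalPhenomena.CardyFormulaZ2.Theorems.CardySelfDualSegmentUniformMarginalitySplit

/-! Route-context MOCK (strategist cstrat-5472-s2, 2026-08-17): renders the two split children exactly as the gate would
(`def <Decl> : Prop := <statement>` with the route file's `open`s; here inside the SUB-namespace `…CardySelfDualSegment.StrategistS2Mock`
so that the published copy can never clash with the gate's future `…CardySelfDualSegment.UniformMarginalityRect`) and checks the
`--glue-by` shape `C₁ → C₂ → UniformMarginality := Split.UniformMarginality_of_two_subs` plus the automatic parent close.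
The un-namespaced variant (children literally in the Theses namespace) was checked in the strategist folder: rc 0, sorries 0. -/

namespace Summit.CriticalPhenomena.CardyFormulaZ2.Theses.CardySelfDualSegment.StrategistS2Mock

open scoped BigOperators Topology Manifold Classical MeasureTheory ProbabilityTheory Matrix InnerProductSpace ComplexConjugate ContinuousMap
open Filter Set Function TopologicalSpace MeasureTheory

/-- mock of split child `UniformMarginalityRect` (crux). -/
def UniformMarginalityRect : Prop :=
  let prm : unitInterval → Literature.Probability.LatticeModels.Site 2 × Fin 2 → unitInterval := fun t i => if i.2 = 0 then Literature.Probability.Percolation.half else Literature.Probability.Percolation.half * t; let cfg : Set (Literature.Probability.LatticeModels.Site 2 × Fin 2) → Literature.Probability.Percolation.BondConfig (Literature.Probability.LatticeModels.Site 2) := fun S => {e | ∃ v : Literature.Probability.LatticeModels.Site 2, (e = s(v, v + ![1, 0]) ∧ (v, (0 : Fin 2)) ∈ S) ∨ (e = s(v, v + ![0, 1]) ∧ ((v, (0 : Fin 2)) ∈ S ↔ (v, (1 : Fin 2)) ∉ S))}; let P : unitInterval → Literature.Probability.RandomPlanarGeometry.ConformalRectangle → ℝ → ℝ := fun t R δ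 => (Literature.Probability.LatticeModels.prodBernoulli (prm t)).real {S | cfg S ∈ Literature.Probability.Percolation.embDomainCrossing Literature.Probability.LatticeModels.squareLatticeEmbedding.z R.carrier δ (R.arc 0) (R.arc 2)}; (∀ (t₀ : unitInterval) (R : Literature.Probability.RandomPlanarGeometry.ConformalRectangle), (∃ S : Finset (ℂ × ℂ), (∀ p ∈ S, p.1.re = p.2.re ∨ p.1.im = p.2.im) ∧ frontier R.carrier ⊆ ⋃ p ∈ S, segment ℝ p.1 p.2) → ∀ (ε : ℝ), 0 < ε → ∃ η > 0, ∀ t : unitInterval, dist t t₀ < η → ∀ δ : ℝ, 0 < δ → |P t R δ - P t₀ R δ| < ε)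

/-- mock of split child `FixedDomainContinuityInterior` (crux). -/
def FixedDomainContinuityInterior : Prop :=
  let prm : unitInterval → Literature.Probability.LatticeModels.Site 2 × Fin 2 → unitInterval := fun t i => if i.2 = 0 then Literature.Probability.Percolation.half else Literature.Probability.Percolation.half * t; let cfg : Set (Literature.Probability.LatticeModels.Site 2 × Fin 2) → Literature.Probability.Percolation.BondConfig (Literature.Probability.LatticeModels.Site 2) := fun S => {e | ∃ v : Literature.Probability.LatticeModels.Site 2, (e = s(v, v + ![1, 0]) ∧ (v, (0 : Fin 2)) ∈ S) ∨ (e = s(v, v + ![0, 1]) ∧ ((v, (0 : Fin 2)) ∈ S ↔ (v, (1 : Fin 2)) ∉ S))}; let P : unitInterval → Literature.Probability.RandomPlanarGeometry.ConformalRectangle → ℝ → ℝ := fun t R δ => (Literature.Probability.LatticeModels.prodBernoulli (prm t)).real {S | cfg S ∈ Literature.Probability.Percolation.embDomainCrossing Literature.Probability.LatticeModels.squareLatticeEmbedding.z R.carrier δ (R.arc 0) (R.arc 2)}; (∀ (R : Literature.Probability.RandomPlanarGeometry.ConformalRectangle) (t₀ : unitInterval), 0 < (t₀ : ℝ) → (t₀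 : ℝ) < 1 → ∀ (ε : ℝ), 0 < ε → ∃ ε₀ > 0, ∀ Q : Literature.Probability.RandomPlanarGeometry.ConformalRectangle, (∃ S : Finset (ℂ × ℂ), (∀ p ∈ S, p.1.re = p.2.re ∨ p.1.im = p.2.im) ∧ frontier Q.carrier ⊆ ⋃ p ∈ S, segment ℝ p.1 p.2) → (∀ u : ℝ, dist (Q.boundary u) (R.boundary u) ≤ ε₀) → (∀ i : Fin 4, |Q.mark i - R.mark i| ≤ ε₀) → ∃ δ₀ > 0, ∀ δ : ℝ, 0 < δ → δ < δ₀ → |P t₀ Q δ - P t₀ R δ| ≤ ε)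

theorem UniformMarginalityGlueBy_holds :
    UniformMarginalityRect → FixedDomainContinuityInterior → UniformMarginality :=
  _root_.Summit.CriticalPhenomena.CardyFormulaZ2.Cruxes.UniformMarginality.HeatFlow.Split.UniformMarginality_of_two_subs

/-- the automatic parent close the gate appends once both children are proved -/
theorem UniformMarginality_holds_mock (h₁ : UniformMarginalityRect) (h₂ : FixedDomainContinuityInterior) :
    UniformMarginality :=
  UniformMarginalityGlueBy_holds h₁ h₂

end Summit.CriticalPhenomena.CardyFormulaZ2.Theses.CardySelfDualSegment.StrategistS2Mock
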